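import Summits.BirchSwinnertonDyer.BirchSwinnertonDyer.Theorems.ManinLocalTwoThreeTowerUnitTwist
import Summits.BirchSwinnertonDyer.Rank1Residual.ManinAdditive.TowerUnitTwist

/-!
# E-an-135 `TowerUnitTwist p` BY NAME ⟸ E-an-137 (by value); E-es-66 / E-es-66₂ ⟸ E-an-137 WITHOUT modularity
# (cell bsd-f2-manin, analytic lens g29, MEMO-an §71; glue over the typer's leaf `…ManinAdditive.TowerUnitTwist`)

Summit `BirchSwinnertonDyer`, route `ManinLocalTwoThree`, cruxes C3 `ManinPrimeToThreeAtNine` (stmt-BirchSwinnertonDyer-22968,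
input `h66`) / C2 `ManinOddAtFour` (stmt-…-22967, input `h66₂`).  The typer's leaf `…ManinAdditive/TowerUnitTwist.lean` types the
cell law E-an-135 `KatoCurve.TowerUnitTwist p` (`@[conjecture]`) and PROVES the edges E-an-136
`threeAdicWitness_of_towerUnitTwist` / `twoAdicWitness_of_towerUnitTwist` modularity-free.  The sibling
`…Theorems.ManinLocalTwoThreeTowerUnitTwist` proves E-an-135 BY VALUE from its f-free parent E-an-137 `UnipotentTowerGeneration p q N`
(not yet a tree `def`; consumed by value, Sketch-an-g29 §4 verbatim).  This file states the composite BY NAME: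

* `towerUnitTwist_of_unipotentTowerGeneration'` — **`KatoCurve.TowerUnitTwist p` ⟸ E-an-137 (by value) for all odd primes
  `q ∤ N`**, every prime `p`.
* `threeAdicWitnessOfPlusIndexPrimeToThree_of_unipotentTowerGeneration'`, `twoAdicWitnessOfPlusIndexOdd_of_unipotentTowerGeneration'`
  — **E-es-66 ⟸ E-an-137(3)**, **E-es-66₂ ⟸ E-an-137(2)** BY NAME, with NO modularity hypothesis (the `hnf` of the sibling's
  corollaries is dropped through the typer's `additive_of_sq_dvd_level`).

So the C2/C3 corollaries of `…NoPlusDefectTower` (lead p1 g9) that take `h135 : TowerUnitTwist p` are now conditional on E-an-137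
(by value) in place of E-an-135.  HONEST FRAMING: E-an-137 is a LAW (Ash–Stevens shape; its injectivity half is a paper theorem,
its extension half open — MEMO-an §71.5).  C2/C3, Manin's conjecture and BSD are NOT proved by this.  No definitions, no sorry.
-/

set_option linter.dupNamespace false
set_option autoImplicit false

noncomputable section

open scoped Classical MatrixGroups ModularForm ComplexConjugate

open CongruenceSubgroup Complex WeierstrassCurve Literature.NumberTheory.EllipticCurves
  Literature.NumberTheory.EllipticCurves.ModularForms
  Summit.BirchSwinnertonDyer.Rank1Residual.ManinAdditive.KatoCurve

namespace Summit.BirchSwinnertonDyer.BirchSwinnertonDyer.Theorems.ManinLocalTwoThree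

/-- **E-an-135 `KatoCurve.TowerUnitTwist p` (BY NAME) ⟸ E-an-137 `UnipotentTowerGeneration p q N` (by value) for all odd
primes `q ∤ N`**, for every prime `p` (Fourier descent + LEMMA W + cyclotomic cofactors, `…Theorems.ManinLocalTwoThreeTowerUnitTwist`). -/
theorem towerUnitTwist_of_unipotentTowerGeneration' {p : ℕ} (hp : p.Prime)
    (hgen : ∀ (q N : ℕ) [NeZero N], q.Prime → q ≠ 2 → ¬ q ∣ N →
      ∀ (f : CuspForm (Gamma0 N) 2) (n₁ : ℕ), ∀ y ∈ periodLatticeGamma1 f,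
        ∃ k : ℕ, ¬ p ∣ k ∧ (k : ℂ) * y ∈ AddSubgroup.closure
          (⋃ (n : ℕ) (_ : n₁ ≤ n) (_ : 1 ≤ n), {z : ℂ | ∃ b t : ℤ, ¬ (q : ℤ) ∣ b ∧
            z = modularSymbol f (((b + t * (q : ℤ) ^ (n - 1) : ℤ) : ℚ) / (q : ℚ) ^ n) -
                modularSymbol f ((b : ℚ) / (q : ℚ) ^ n)})) :
    TowerUnitTwist p := by
  intro W _ N _ f hWf hd q _ hq2 hqp hqN hpq n₁
  exact exists_unitTwistAt_of_towerGeneration hWf hp hd hq2 hqp hqN hpq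
    (fun n₁' ↦ hgen q N Fact.out hq2 hqN f n₁') n₁

/-- **E-es-66 ⟸ E-an-137(3)**, modularity-free and BY NAME: `KatoCurve.ThreeAdicWitnessOfPlusIndexPrimeToThree` follows from
the `3`-adic unipotent tower-generation law at every odd prime `q ∤ N` (via `towerUnitTwist_of_unipotentTowerGeneration'` and the
typer's E-an-136₃ `threeAdicWitness_of_towerUnitTwist`). -/
theorem threeAdicWitnessOfPlusIndexPrimeToThree_of_unipotentTowerGeneration'
    (hgen : ∀ (q N : ℕ) [NeZero N], q.Prime → q ≠ 2 → ¬ q ∣ N →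
      ∀ (f : CuspForm (Gamma0 N) 2) (n₁ : ℕ), ∀ y ∈ periodLatticeGamma1 f,
        ∃ k : ℕ, ¬ 3 ∣ k ∧ (k : ℂ) * y ∈ AddSubgroup.closure
          (⋃ (n : ℕ) (_ : n₁ ≤ n) (_ : 1 ≤ n), {z : ℂ | ∃ b t : ℤ, ¬ (q : ℤ) ∣ b ∧
            z = modularSymbol f (((b + t * (q : ℤ) ^ (n - 1) : ℤ) : ℚ) / (q : ℚ) ^ n) -
                modularSymbol f ((b : ℚ) / (q : ℚ) ^ n)})) :
    ThreeAdicWitnessOfPlusIndexPrimeToThree :=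
  threeAdicWitness_of_towerUnitTwist (towerUnitTwist_of_unipotentTowerGeneration' Nat.prime_three hgen)

/-- **E-es-66₂ ⟸ E-an-137(2)**, modularity-free and BY NAME: `KatoCurve.TwoAdicWitnessOfPlusIndexOdd` from the `2`-adic unipotent
tower-generation law at every odd prime `q ∤ N` (via the typer's E-an-136₂ `twoAdicWitness_of_towerUnitTwist`). -/
theorem twoAdicWitnessOfPlusIndexOdd_of_unipotentTowerGeneration'
    (hgen : ∀ (q N : ℕ) [NeZero N], q.Prime → q ≠ 2 → ¬ q ∣ N →
      ∀ (f : CuspForm (Gamma0 N) 2) (n₁ : ℕ), ∀ y ∈ periodLatticeGamma1 f,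
        ∃ k : ℕ, ¬ 2 ∣ k ∧ (k : ℂ) * y ∈ AddSubgroup.closure
          (⋃ (n : ℕ) (_ : n₁ ≤ n) (_ : 1 ≤ n), {z : ℂ | ∃ b t : ℤ, ¬ (q : ℤ) ∣ b ∧
            z = modularSymbol f (((b + t * (q : ℤ) ^ (n - 1) : ℤ) : ℚ) / (q : ℚ) ^ n) -
                modularSymbol f ((b : ℚ) / (q : ℚ) ^ n)})) :
    TwoAdicWitnessOfPlusIndexOdd :=
  twoAdicWitness_of_towerUnitTwist (towerUnitTwist_of_unipotentTowerGeneration' Nat.prime_two hgen)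

end Summit.BirchSwinnertonDyer.BirchSwinnertonDyer.Theorems.ManinLocalTwoThree

end
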